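import Summits.QuantumFields.QCD.Theorems.QuarksAsStableActionStableActionBridgeStubFockGaugeActChargeConj
import Summits.QuantumFields.QCD.Theorems.QuarksAsStableActionStableActionBridgeStubFermionSliceOpChargeConj
import Literature.MathematicalPhysics.QuantumLattice.HubbardModelParticleHoleProofs
import HarnessLib

/-!
# The charge-conjugation matrix `𝒱 = P_hᴴ Γ(1 ⊗ w)`: unitarity and intertwining
(stub `stub_chargeConjMatrix_intertwine` of line `twisted_trace_transfer` for crux
`QuarksAsStableAction.StableActionBridge`, item stmt-QuantumFields-9737, `--supports`; sub-goal W7d)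

To prove that the vacuum of Lüscher's transfer matrix of lattice QCD is fermion-even, the line uses the
charge-conjugation matrix `𝒱 := P_hᴴ Γ_W` of the slice Fock space, where `P_h = particleHole 1` is the
particle–hole map and `Γ_W = Γ(W̃)`, `W̃ = reindex e e (1 ⊗ w)`, `w = C γ₄` (`C = chargeConj`,
`Γ = fockLift`, `e = sliceQuarkEquiv`), together with complex conjugation `U ↦ Ū` (`suConj 3`) of the
links.  This file packages the three properties of `𝒱` used there, from the landed conjugation laws
`stub_fockGaugeAct_chargeConj` (V1) and `stub_fermionSliceOp_chargeConj` (V2):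

1. **`𝒱` is unitary.**  `P_h` is unitary for unimodular phases (Tasaki §9.3.3,
   `particleHole_conjTranspose_mul` / `particleHole_mul_conjTranspose`), and `Γ_W` is unitary because
   `w` is (`cg0_mem_unitaryGroup`), hence `1 ⊗ w` is (`sliceKron` is multiplicative and `ᴴ`-compatible),
   hence its reindexing is (`submatrix_equiv_conjTranspose_mul_self`), hence its second quantisation is
   (`fockLift_conjTranspose_mul_self`); a product of unitaries is unitary.
2. **`Γ(G_g) 𝒱 = 𝒱 Γ(G_ḡ)`.**  From V1 (a), `P_h Γ(G_g) P_hᴴ = Γ(G_ḡ)`, multiplying by `P_hᴴ` on the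
   left gives `Γ(G_g) P_hᴴ = P_hᴴ Γ(G_ḡ)`; then `Γ(G_g) P_hᴴ Γ_W = P_hᴴ Γ(G_ḡ) Γ_W = P_hᴴ Γ_W Γ(G_ḡ)` by
   V1 (b) at `ḡ`.
3. **`T̂_F(U) 𝒱 = 𝒱 T̂_F(Ū)`.**  From V2, `P_h T̂_F(U) P_hᴴ = Γ_W T̂_F(Ū) Γ_Wᴴ`, so
   `T̂_F(U) P_hᴴ = P_hᴴ Γ_W T̂_F(Ū) Γ_Wᴴ` and `T̂_F(U) P_hᴴ Γ_W = P_hᴴ Γ_W T̂_F(Ū) (Γ_Wᴴ Γ_W) = P_hᴴ Γ_W T̂_F(Ū)`.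

Pure theorem file (no definitions, no local notations); helpers in the sub-namespace
`StubChargeConjMatrixIntertwine`.

[cite: Smit2023, §4.6 (4.124)–(4.127) and §6.5 (6.91)] [cite: LuciniEtAl2016, §2 and App. D]
-/

noncomputable section

open scoped Matrix BigOperators ComplexConjugate
open Literature.MathematicalPhysics.QuantumFieldTheory Literature.MathematicalPhysics.QuantumLattice
open Literature.Probability.LatticeModels (TorusSite)

namespace Summit.QuantumFields.QCD.Cruxes.StableActionBridge.TwistedTraceTransfer

namespace StubChargeConjMatrixIntertwine

open Matrix
open Summit.QuantumFields.QCD.Cruxes.StableActionBridge.Sketch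

variable {Nf S : ℕ} [NeZero S]

/-- **The particle–hole map `P_h = particleHole 1` of the slice Fock space is unitary**:
`P_hᴴ P_h = 1 = P_h P_hᴴ` (unimodular — here trivial — phases). [cite: Tasaki2020, §9.3.3] -/
theorem particleHole_one_unitary :
    (particleHole (fun _ : SliceFermiIdx Nf S => (1 : ℂ)))ᴴ *
        particleHole (fun _ : SliceFermiIdx Nf S => (1 : ℂ)) = 1 ∧
      particleHole (fun _ : SliceFermiIdx Nf S => (1 : ℂ)) *
        (particleHole (fun _ : SliceFermiIdx Nf S => (1 : ℂ)))ᴴ = 1 :=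
  ⟨particleHole_conjTranspose_mul _ fun _ => norm_one,
    particleHole_mul_conjTranspose _ fun _ => norm_one⟩

/-- **`1 ⊗ w` is unitary** for `w = C γ₄`: `(1 ⊗ w)ᴴ (1 ⊗ w) = 1 ⊗ (wᴴ w) = 1` and
`(1 ⊗ w)(1 ⊗ w)ᴴ = 1 ⊗ (w wᴴ) = 1`. [folklore] -/
theorem sliceKron_one_cg0_unitary :
    (sliceKron (1 : Matrix (SliceColourVar Nf S) (SliceColourVar Nf S) ℂ) (chargeConj * euclideanGamma 0))ᴴ *
        sliceKron (1 : Matrix (SliceColourVar Nf S) (SliceColourVar Nf S) ℂ) (chargeConj * euclideanGamma 0) = 1 ∧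
      sliceKron (1 : Matrix (SliceColourVar Nf S) (SliceColourVar Nf S) ℂ) (chargeConj * euclideanGamma 0) *
        (sliceKron (1 : Matrix (SliceColourVar Nf S) (SliceColourVar Nf S) ℂ) (chargeConj * euclideanGamma 0))ᴴ = 1 := by
  rw [SliceNilpotent.sliceKron_conjTranspose, Matrix.conjTranspose_one, SliceNilpotent.sliceKron_mul,
    SliceNilpotent.sliceKron_mul, Matrix.mul_one, ← Matrix.star_eq_conjTranspose,
    Matrix.mem_unitaryGroup_iff'.1 StubFermionSliceMatrixChargeConj.cg0_mem_unitaryGroup,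
    Matrix.mem_unitaryGroup_iff.1 StubFermionSliceMatrixChargeConj.cg0_mem_unitaryGroup,
    SliceNilpotent.sliceKron_one_one]
  exact ⟨rfl, rfl⟩

/-- **`Γ_W = Γ(reindex e e (1 ⊗ w))` is unitary**: `Γ_Wᴴ Γ_W = 1 = Γ_W Γ_Wᴴ` — reindexing and second
quantisation transport the unitarity of `1 ⊗ w`. [cite: Smit2023, §4.6 (4.125)–(4.127)] -/
theorem fockLift_cg0_unitary :
    (fockLift (Matrix.reindex sliceQuarkEquiv sliceQuarkEquiv
        (sliceKron (1 : Matrix (SliceColourVar Nf S) (SliceColourVar Nf S) ℂ) (chargeConj * euclideanGamma 0))))ᴴ *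
        fockLift (Matrix.reindex sliceQuarkEquiv sliceQuarkEquiv
          (sliceKron (1 : Matrix (SliceColourVar Nf S) (SliceColourVar Nf S) ℂ) (chargeConj * euclideanGamma 0))) = 1 ∧
      fockLift (Matrix.reindex sliceQuarkEquiv sliceQuarkEquiv
          (sliceKron (1 : Matrix (SliceColourVar Nf S) (SliceColourVar Nf S) ℂ) (chargeConj * euclideanGamma 0))) *
        (fockLift (Matrix.reindex sliceQuarkEquiv sliceQuarkEquiv
          (sliceKron (1 : Matrix (SliceColourVar Nf S) (SliceColourVar Nf S) ℂ) (chargeConj * euclideanGamma 0))))ᴴ = 1 := by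
  rw [Matrix.reindex_apply]
  exact SliceGaugeUnitarity.fockLift_conjTranspose_mul_self _
    (SliceGaugeUnitarity.submatrix_equiv_conjTranspose_mul_self _ _ sliceKron_one_cg0_unitary)

/-- **Left-multiplication transport**: if `Pᴴ P = 1` and `P X Pᴴ = Y` then `X Pᴴ = Pᴴ Y`. [folklore] -/
theorem mul_conjTranspose_eq_of_conj_eq {n : Type*} [Fintype n] [DecidableEq n]
    {P X Y : Matrix n n ℂ} (hP : Pᴴ * P = 1) (h : P * X * Pᴴ = Y) : X * Pᴴ = Pᴴ * Y := by
  rw [← h, ← Matrix.mul_assoc, ← Matrix.mul_assoc, hP, Matrix.one_mul]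

end StubChargeConjMatrixIntertwine

/-- **Sub-goal W7d (registered stub `stub_chargeConjMatrix_intertwine`): the charge-conjugation matrix
`𝒱 = P_hᴴ Γ(1 ⊗ w)` is unitary and intertwines the Fock gauge rotations and Smit's fermionic transfer
operator with their charge conjugates** (`Γ(G_g) 𝒱 = 𝒱 Γ(G_ḡ)`, `T̂_F(U) 𝒱 = 𝒱 T̂_F(Ū)`): `P_h` and
`Γ(1 ⊗ w)` are unitary; `P_h Γ(G_g) P_hᴴ = Γ(G_ḡ)` and `Γ(1 ⊗ w) Γ(G_ḡ) = Γ(G_ḡ) Γ(1 ⊗ w)`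
(`stub_fockGaugeAct_chargeConj`); `P_h T̂_F(U) P_hᴴ = Γ(1 ⊗ w) T̂_F(Ū) Γ(1 ⊗ w)ᴴ`
(`stub_fermionSliceOp_chargeConj`) and `Γ(1 ⊗ w)ᴴ Γ(1 ⊗ w) = 1`.
[cite: Smit2023, §4.6 (4.124)–(4.127) and §6.5 (6.91)] [cite: LuciniEtAl2016, §2 and App. D] -/
theorem stub_chargeConjMatrix_intertwine : ∀ (Nf S : ℕ) [NeZero S] (mq : Fin Nf → ℝ), (∀ f, -1 < mq f) →
    (particleHole (fun _ : SliceFermiIdx Nf S => (1 : ℂ)))ᴴ * fockLift (Matrix.reindex sliceQuarkEquiv sliceQuarkEquiv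
        (sliceKron (1 : Matrix (SliceColourVar Nf S) (SliceColourVar Nf S) ℂ) (chargeConj * euclideanGamma 0))) ∈ Matrix.unitaryGroup (Finset (SliceFermiIdx Nf S)) ℂ ∧
    (∀ g : TorusSite 3 S → (Matrix.specialUnitaryGroup (Fin 3) ℂ),
      @fockGaugeAct Nf S _ g * ((particleHole (fun _ : SliceFermiIdx Nf S => (1 : ℂ)))ᴴ * fockLift (Matrix.reindex sliceQuarkEquiv sliceQuarkEquiv
        (sliceKron (1 : Matrix (SliceColourVar Nf S) (SliceColourVar Nf S) ℂ) (chargeConj * euclideanGamma 0)))) =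
        ((particleHole (fun _ : SliceFermiIdx Nf S => (1 : ℂ)))ᴴ * fockLift (Matrix.reindex sliceQuarkEquiv sliceQuarkEquiv
        (sliceKron (1 : Matrix (SliceColourVar Nf S) (SliceColourVar Nf S) ℂ) (chargeConj * euclideanGamma 0)))) * @fockGaugeAct Nf S _ (fun x => suConj 3 (g x))) ∧
    (∀ U : GaugeConfig 3 S (Matrix.specialUnitaryGroup (Fin 3) ℂ),
      fermionSliceOp U mq * ((particleHole (fun _ : SliceFermiIdx Nf S => (1 : ℂ)))ᴴ * fockLift (Matrix.reindex sliceQuarkEquiv sliceQuarkEquiv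
        (sliceKron (1 : Matrix (SliceColourVar Nf S) (SliceColourVar Nf S) ℂ) (chargeConj * euclideanGamma 0)))) =
        ((particleHole (fun _ : SliceFermiIdx Nf S => (1 : ℂ)))ᴴ * fockLift (Matrix.reindex sliceQuarkEquiv sliceQuarkEquiv
        (sliceKron (1 : Matrix (SliceColourVar Nf S) (SliceColourVar Nf S) ℂ) (chargeConj * euclideanGamma 0)))) * fermionSliceOp (fun e => suConj 3 (U e)) mq) := by
  intro Nf S _ mq hm
  obtain ⟨hP1, hP2⟩ := StubChargeConjMatrixIntertwine.particleHole_one_unitary (Nf := Nf) (S := S)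
  obtain ⟨hW1, hW2⟩ := StubChargeConjMatrixIntertwine.fockLift_cg0_unitary (Nf := Nf) (S := S)
  refine ⟨?_, fun g => ?_, fun U => ?_⟩
  · -- (1) unitarity: `P_hᴴ` and `Γ_W` are unitary, hence so is their product
    exact mul_mem (Unitary.star_mem (U := particleHole (fun _ : SliceFermiIdx Nf S => (1 : ℂ))) ⟨hP1, hP2⟩)
      ⟨hW1, hW2⟩
  · -- (2) `Γ(G_g) P_hᴴ Γ_W = P_hᴴ Γ(G_ḡ) Γ_W = P_hᴴ Γ_W Γ(G_ḡ)`
    have key := StubChargeConjMatrixIntertwine.mul_conjTranspose_eq_of_conj_eq hP1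
      (stub_fockGaugeAct_chargeConj Nf S g).1
    have hcomm := (stub_fockGaugeAct_chargeConj Nf S (fun x => suConj 3 (g x))).2.1
    rw [← Matrix.mul_assoc, key, Matrix.mul_assoc, ← hcomm, Matrix.mul_assoc]
  · -- (3) `T̂_F(U) P_hᴴ Γ_W = P_hᴴ Γ_W T̂_F(Ū) Γ_Wᴴ Γ_W = P_hᴴ Γ_W T̂_F(Ū)`
    have key := StubChargeConjMatrixIntertwine.mul_conjTranspose_eq_of_conj_eq hP1
      (stub_fermionSliceOp_chargeConj Nf S mq hm U)
    rw [← Matrix.mul_assoc, key]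
    simp only [Matrix.mul_assoc]
    rw [hW1, Matrix.mul_one]

end Summit.QuantumFields.QCD.Cruxes.StableActionBridge.TwistedTraceTransfer

end
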